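import Literature.AlgebraicGeometry.Pohlmann1968.DivisorClassesCMAlgebra
import Mathlib.NumberTheory.NumberField.CMField
import Mathlib.NumberTheory.Cyclotomic.PrimitiveRoots
import Mathlib.RingTheory.RootsOfUnity.Complex

/-!
# Weil's exceptional Hodge classes on CM abelian varieties of Weil type: the barrier fact
# `Weil1977_exceptionalHodgeClasses` from the existence of CM abelian varieties

The barrier fact `Literature.Barriers.HodgeConjecture.Weil1977_exceptionalHodgeClasses` (van Geemen, LNM 1594,
Thm. 4.11 (Weil 1977): for every `n ≥ 2` a complex abelian `2n`-fold with a rational `(n,n)`-class OUTSIDE the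
ring `Dⁿ` of divisor classes) is PROVED here from the single existence record
`PicardCM.CMAbelianVarietyRealised` (Shimura 1998, §6.2 Thm. 3: CM abelian varieties of every CM type exist, read
on `H¹`) — the displayed hypothesis `h₃` of the COR-CM cell — by Pohlmann's criterion in the CM-algebra form
PROVED in `Pohlmann1968/DivisorClassesCMAlgebra` (`exists_exceptional_biproduct_iff`: a product of realisations
carries a rational `(m,m)`-class outside `Dᵐ ⊗ ℂ` iff some Galois-balanced `2m`-set of embeddings is not a
disjoint union of balanced pairs; Gordon 1999, §9.2 and 9.2.2).

THE WITNESSES (Mumford–Pohlmann–Weil's mechanism, van Geemen 4.7: "the imaginary quadratic field was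
'responsible' for the exceptional Hodge cycles"; Moonen–Zarhin 1999, Thm. 0.1 case (a): for `X = X₁ × X₂`, `X₁`
an elliptic curve with CM by an imaginary quadratic `k`, `X₂` a simple CM threefold with `k ↪ End⁰(X₂)`, the
Weil classes `W_k ⊂ B²(X)` are needed, `D²(X) ≠ B²(X)`).  Let `A₉` be a realisation of the CM type
`Φ₉ = {σ₁, σ₂, σ₄}` of `ℚ(ζ₉)` (`σ_a : ζ₉ ↦ ζ^a`, `ζ = e^{2πi/9}`, `a ∈ (ℤ/9)ˣ`) and `E` a realisation of the
CM type `Φ₃ = {ζ₃ ↦ ζ⁶}` of `ℚ(ζ₃) = ℚ(√-3)`.  The imaginary quadratic field `k = ℚ(ζ₃) ⊂ ℚ(ζ₉)` acts on the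
fourfold `A₀ = A₉ × E` with multiplicities `(2, 2)` (Weil type), and its Weil class has the weight
`S₀ = {σ₁, σ₄, σ₇} ⊔ {ι₃}` (the embeddings of `ℚ(ζ₉) × ℚ(ζ₃)` restricting to `ζ₃ ↦ ζ³`): `S₀` is Galois balanced
(for `τ ∈ Aut(ℂ)` with `τζ = ζ^u`: if `u ≡ 1 (3)` then `u·{1,4,7} = {1,4,7}` meets `{1,2,4}` in two elements and
`3u = 3`; if `u ≡ 2 (3)` it meets it in one element and `3u = 6 ∈ Φ₃`), but `σ₁` has NO balanced partner in
`S₀` (test `u = 1, 4, 7`), so `S₀` is not a disjoint union of balanced pairs: `B²(A₀) ≠ D²(A₀)`.  For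
`n = k + 2` the `2n`-fold is `A = A₉ × E × E^k × E^k` with the weight `S = S₀ ⊔ (k full blocks {ι₃, ι₆})`, i.e.
the class `w ⊠ [pt]^{⊠ k} ⊠ 1` — balanced, of size `2n`, and still without a balanced partner for `σ₁`.

## Structure

* §1 `Aut(ℂ)` on the ninth roots of unity: `autExp τ ∈ ℤ/9` with `τ ζ = ζ^{u(τ)}`, `u(conj) = -1`, every
  `u ∈ (ℤ/9)ˣ` occurs (`Complex.exists_ringEquiv_apply_eq_of_aeval_minpoly_eq_zero` of the tree).
* §2–§3 exponents `e(σ) ∈ ℤ/9` of the complex embeddings of `ℚ(ζ₉)` and `ℚ(ζ₃)` (`σ ζ₉ = ζ^{e(σ)}`,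
  `σ ζ₃ = ζ^{e(σ)} ∈ {ζ³, ζ⁶}`), EQUIVARIANT for the SAME `u(τ)` (both are powers of the one `ζ ∈ ℂ`); injective,
  with the expected ranges (Mathlib's `IsPrimitiveRoot.embeddingsEquivPrimitiveRoots`); the CM types `Φ₉`, `Φ₃`.
  The fields are ABSTRACT (`IsCyclotomicExtension {9} ℚ L₉`, `{3}` for `L₃`) and instantiated at the end with
  Mathlib's `CyclotomicField` (whose `ℚ`-algebra structure agrees with `DivisionRing.toRatAlgebra` only up to
  unfolding, whence the explicit instance terms in the final proof).
* §4 the combinatorial MODEL `ℤ/9 ⊔ (Fin m × ℤ/9)` of `⊔_i Hom(K_i, ℂ)` with the action `u · –`, the model of the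
  CM types and of the weight `S`; the two counts (`card_filter_modelSet`, by `decide` on `ℤ/9` plus bookkeeping
  over the `k` full blocks) and the no-partner lemma (`no_partner_model`, by `decide`).
* §5 exponent data on an abstract family `K : Fin (m+1) → Type` (`ExpData`), the code map to the model
  (injective, equivariant), the transfer of the two `ncard`s of `IsGaloisBalancedAlg` to the model, and the two
  properties of the witness weight: `witnessSet_mem_pohlmannSetsAlg`, `witnessSet_not_mem_pohlmannDivisorSetsAlg`.
* §6 the family `Kfam = (ℚ(ζ₉), ℚ(ζ₃), …, ℚ(ζ₃))` (`Fin.cons`), its CM types, exponent data and realisations,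
  `dim (⨁ A) = 3 + m` (a private copy of the standard biproduct bookkeeping), and the exceptional class
  `exists_exceptional_fam` by `exists_exceptional_biproduct_iff`.
* §7 `weil1977_exceptionalHodgeClasses_of_cmAbelianVarietyRealised : CMAbelianVarietyRealised →
  Weil1977_exceptionalHodgeClasses`.

No named fact is introduced; no `sorry`.  NOT here: the SIMPLE fourfolds of Mumford–Pohlmann
(`Mumford1968_simpleFourfold_exceptionalHodgeClasses`, van Geemen Thm. 4.5 — they need the Galois theory of a
specific CM field of degree `8` with non-abelian Galois closure and a simplicity criterion for CM types, neither of
which is in the tree; the products used here are not simple); the Weil-type structure of `A₉ × E` as the tree's `HodgeTheory.IsWeilType` (only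
the weight computation is used); an unconditional existence of `A₉`, `E` (the tree constructs CM abelian
varieties only through the record `CMAbelianVarietyRealised`).

## References

* [vanGeemen1994HodgeAV] B. van Geemen, *An introduction to the Hodge conjecture for abelian varieties*, LNM
  1594 (1994): Thm. 4.11 (Weil), 4.7 (Weil's observation on Mumford's example), Def. 4.9–4.10, §2.4–2.5.
* [Weil1977HodgeRing] A. Weil, *Abelian varieties and the Hodge ring* [1977c], Œuvres III, 421–429.
* [Pohlmann1968] H. Pohlmann, Ann. of Math. (2) 88 (1968) 161–180: Thm. 1 and §3 (Mumford's example).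
* [Gordon1999HodgeAVSurvey] B. B. Gordon, *A survey of the Hodge conjecture for abelian varieties*, §9.2
  (Pohlmann's criterion, with proof) and 9.2.2 Corollary (White).
* [MoonenZarhin1999LowDim] B. Moonen, Yu. Zarhin, Math. Ann. 315 (1999) 711–733, Thm. 0.1, case (a) and the
  remark after it (`D² ≠ B²` for `E × X₂`, `k ↪ End⁰(X₂)`).
* [Shimura1998] G. Shimura, *Abelian Varieties with Complex Multiplication and Modular Functions*, §6.2 Thm. 3.
* [MumfordAV1970] D. Mumford, *Abelian Varieties*, §19; [GortzWedhorn2020] Lemma 6.26 (dimension of products).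
-/

noncomputable section

open NumberField Polynomial

namespace Literature.AlgebraicGeometry.Pohlmann1968

namespace WeilTypeWitness

/-! ### §1 `Aut(ℂ)` on the ninth roots of unity -/

/-- The chosen primitive ninth root of unity `ζ = e^{2πi/9} ∈ ℂ`. [folklore] -/
def ζ : ℂ := Complex.exp (2 * Real.pi * Complex.I / 9)

/-- `ζ` is a primitive ninth root of unity. [folklore] -/
private theorem isPrimitiveRoot_ζ : IsPrimitiveRoot ζ 9 := by
  simpa [ζ] using Complex.isPrimitiveRoot_exp 9 (by norm_num)

/-- `ζ⁹ = 1`. [folklore] -/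
private theorem ζ_pow_nine : ζ ^ 9 = 1 := isPrimitiveRoot_ζ.pow_eq_one

/-- Every automorphism of `ℂ` raises `ζ` to a power prime to `9`. [folklore] -/
private theorem exists_ringEquiv_apply_ζ (τ : ℂ ≃+* ℂ) : ∃ i < 9, i.Coprime 9 ∧ ζ ^ i = τ ζ := by
  have hτ : IsPrimitiveRoot (τ ζ) 9 := isPrimitiveRoot_ζ.map_of_injective τ.injective
  exact (isPrimitiveRoot_ζ.isPrimitiveRoot_iff).1 hτ

/-- The exponent `u(τ) ∈ ℤ/9` of an automorphism `τ` of `ℂ` on the ninth roots of unity: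
`τ ζ = ζ^{u(τ)}`. [folklore] -/
def autExp (τ : ℂ ≃+* ℂ) : ZMod 9 := ((Classical.choose (exists_ringEquiv_apply_ζ τ) : ℕ) : ZMod 9)

/-- Defining property of the exponent: `τ ζ = ζ^{u(τ)}`. [folklore] -/
private theorem autExp_spec (τ : ℂ ≃+* ℂ) : τ ζ = ζ ^ (autExp τ).val := by
  obtain ⟨hi, -, h⟩ := Classical.choose_spec (exists_ringEquiv_apply_ζ τ)
  rw [autExp, ZMod.val_natCast, Nat.mod_eq_of_lt hi, h]

/-- The exponent `u(τ)` is prime to `9` (`τ ζ` is again a primitive ninth root of unity). [folklore] -/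
private theorem coprime_autExp (τ : ℂ ≃+* ℂ) : (autExp τ).val.Coprime 9 := by
  obtain ⟨hi, hc, -⟩ := Classical.choose_spec (exists_ringEquiv_apply_ζ τ)
  rw [autExp, ZMod.val_natCast, Nat.mod_eq_of_lt hi]
  exact hc

/-- `τ (ζ^c) = ζ^{u(τ) c}` for every exponent `c ∈ ℤ/9`. [folklore] -/
private theorem ringEquiv_apply_ζ_pow (τ : ℂ ≃+* ℂ) (c : ZMod 9) :
    τ (ζ ^ c.val) = ζ ^ (autExp τ * c).val := by
  rw [map_pow, autExp_spec, ← pow_mul, ZMod.val_mul, ← pow_eq_pow_mod _ ζ_pow_nine]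

/-- Exponents are read off injectively: `ζ^a = ζ^b ↔ a = b` in `ℤ/9`. [folklore] -/
private theorem ζ_pow_inj {a b : ZMod 9} (h : ζ ^ a.val = ζ ^ b.val) : a = b :=
  ZMod.val_injective 9 (isPrimitiveRoot_ζ.pow_inj (ZMod.val_lt a) (ZMod.val_lt b) h)

/-- The identity has exponent `1`. [folklore] -/
private theorem autExp_refl : autExp (RingEquiv.refl ℂ) = 1 := by
  apply ζ_pow_inj
  rw [← autExp_spec, show (1 : ZMod 9).val = 1 from rfl, pow_one]
  rfl

/-- Complex conjugation has exponent `-1`. [folklore] -/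
private theorem autExp_conj : autExp (starRingAut : ℂ ≃+* ℂ) = -1 := by
  apply ζ_pow_inj
  rw [← autExp_spec]
  have h1 : ‖ζ‖ = 1 := Complex.norm_eq_one_of_pow_eq_one ζ_pow_nine (by norm_num)
  have h8 : ζ ^ (-1 : ZMod 9).val = ζ⁻¹ := by
    rw [show (-1 : ZMod 9).val = 8 by decide]
    exact eq_inv_of_mul_eq_one_left (by rw [← pow_succ, ζ_pow_nine])
  rw [h8, Complex.inv_eq_conj h1]
  rfl

/-- Every exponent prime to `9` is realised by an automorphism of `ℂ` (the primitive ninth roots of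
unity are conjugate over `ℚ`). [folklore] -/
private theorem exists_autExp_eq (u : ZMod 9) (hu : u.val.Coprime 9) : ∃ τ : ℂ ≃+* ℂ, autExp τ = u := by
  have hint : IsIntegral ℚ ζ := (isPrimitiveRoot_ζ.isIntegral (by norm_num)).tower_top
  have hroot : aeval (ζ ^ u.val) (minpoly ℚ ζ) = 0 := by
    rw [← cyclotomic_eq_minpoly_rat isPrimitiveRoot_ζ (by norm_num), aeval_def, ← eval_map,
      map_cyclotomic, ← IsRoot.def, isRoot_cyclotomic_iff]
    exact isPrimitiveRoot_ζ.pow_of_coprime u.val hu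
  obtain ⟨τ, hτ⟩ :=
    Literature.FieldTheory.AlgClosed.Complex.exists_ringEquiv_apply_eq_of_aeval_minpoly_eq_zero hint hroot
  exact ⟨τ, ζ_pow_inj (by rw [← autExp_spec, hτ])⟩

/-! ### §2 Exponents of the complex embeddings of a field generated by a ninth root of unity -/

section Emb

variable {L : Type} [Field L] {x : L}

/-- For `x ∈ L` with `x⁹ = 1`, every embedding `σ : L → ℂ` sends `x` to a power of `ζ`. [folklore] -/
private theorem exists_apply_eq_ζ_pow (hx : x ^ 9 = 1) (σ : L →+* ℂ) : ∃ i < 9, ζ ^ i = σ x :=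
  isPrimitiveRoot_ζ.eq_pow_of_pow_eq_one (by rw [← map_pow, hx, map_one])

/-- The exponent `e(σ) ∈ ℤ/9` of an embedding on a ninth root of unity `x`: `σ x = ζ^{e(σ)}`.
[folklore] -/
def embExp (hx : x ^ 9 = 1) (σ : L →+* ℂ) : ZMod 9 :=
  ((Classical.choose (exists_apply_eq_ζ_pow hx σ) : ℕ) : ZMod 9)

/-- Defining property of the exponent of an embedding: `σ x = ζ^{e(σ)}`. [folklore] -/
private theorem embExp_spec (hx : x ^ 9 = 1) (σ : L →+* ℂ) : σ x = ζ ^ (embExp hx σ).val := by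
  obtain ⟨hi, h⟩ := Classical.choose_spec (exists_apply_eq_ζ_pow hx σ)
  rw [embExp, ZMod.val_natCast, Nat.mod_eq_of_lt hi, h]

/-- The exponent is determined by `σ x`. [folklore] -/
private theorem embExp_eq_of_apply_eq (hx : x ^ 9 = 1) {σ : L →+* ℂ} {c : ZMod 9} (h : σ x = ζ ^ c.val) :
    embExp hx σ = c :=
  ζ_pow_inj (by rw [← embExp_spec, h])

/-- **Equivariance**: `e(τ ∘ σ) = u(τ) · e(σ)`. [folklore] -/
private theorem embExp_comp (hx : x ^ 9 = 1) (τ : ℂ ≃+* ℂ) (σ : L →+* ℂ) :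
    embExp hx ((τ : ℂ →+* ℂ).comp σ) = autExp τ * embExp hx σ :=
  embExp_eq_of_apply_eq hx (by rw [RingHom.comp_apply, embExp_spec hx σ]; exact ringEquiv_apply_ζ_pow τ _)

/-- Complex conjugation negates the exponent. [folklore] -/
private theorem embExp_conjugate (hx : x ^ 9 = 1) (σ : L →+* ℂ) :
    embExp hx (ComplexEmbedding.conjugate σ) = - embExp hx σ := by
  have h : ComplexEmbedding.conjugate σ = ((starRingAut : ℂ ≃+* ℂ) : ℂ →+* ℂ).comp σ := rfl
  rw [h, embExp_comp, autExp_conj, neg_one_mul]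

end Emb

/-! ### §3 Cyclotomic fields of conductor `9` and `3`: embeddings and the two CM types -/

section Nine

variable (L : Type) [Field L] [NumberField L] [IsCyclotomicExtension {9} ℚ L]

/-- The generator `ζ₉ ∈ L = ℚ(ζ₉)` (Mathlib's `IsCyclotomicExtension.zeta`). [folklore] -/
abbrev z₉ : L := IsCyclotomicExtension.zeta 9 ℚ L

/-- `ζ₉` is a primitive ninth root of unity. [folklore] -/
private theorem z₉_spec : IsPrimitiveRoot (z₉ L) 9 := IsCyclotomicExtension.zeta_spec 9 ℚ L

/-- `ζ₉⁹ = 1`. [folklore] -/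
private theorem z₉_pow : z₉ L ^ 9 = 1 := (z₉_spec L).pow_eq_one

/-- The exponent `e(σ) ∈ (ℤ/9)ˣ` of an embedding `σ` of `L = ℚ(ζ₉)`: `σ ζ₉ = ζ^{e(σ)}`. [folklore] -/
def exp₉ (σ : L →+* ℂ) : ZMod 9 := embExp (z₉_pow L) σ

/-- `σ ζ₉ = ζ^{e(σ)}`. [folklore] -/
private theorem exp₉_spec (σ : L →+* ℂ) : σ (z₉ L) = ζ ^ (exp₉ L σ).val := embExp_spec (z₉_pow L) σ

/-- The exponent of an embedding of `ℚ(ζ₉)` is determined by the image of `ζ₉`. [folklore] -/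
private theorem exp₉_eq_of_apply_eq {σ : L →+* ℂ} {c : ZMod 9} (h : σ (z₉ L) = ζ ^ c.val) : exp₉ L σ = c :=
  embExp_eq_of_apply_eq (z₉_pow L) h

/-- `e(τ ∘ σ) = u(τ) e(σ)`. [folklore] -/
private theorem exp₉_comp (τ : ℂ ≃+* ℂ) (σ : L →+* ℂ) : exp₉ L ((τ : ℂ →+* ℂ).comp σ) = autExp τ * exp₉ L σ :=
  embExp_comp (z₉_pow L) τ σ

/-- `e(σ̄) = -e(σ)`. [folklore] -/
private theorem exp₉_conjugate (σ : L →+* ℂ) : exp₉ L (ComplexEmbedding.conjugate σ) = - exp₉ L σ :=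
  embExp_conjugate (z₉_pow L) σ

/-- The ninth cyclotomic polynomial is irreducible over `ℚ`. [folklore] -/
private theorem irreducible_cyclotomic_nine : Irreducible (cyclotomic 9 ℚ) := cyclotomic.irreducible_rat (by norm_num)

/-- Embeddings of `ℚ(ζ₉)` are determined by their exponent. [folklore] -/
private theorem exp₉_injective : Function.Injective (exp₉ L) := by
  intro σ σ' h
  have hz : σ (z₉ L) = σ' (z₉ L) := by
    rw [exp₉_spec L σ, exp₉_spec L σ']
    exact congrArg (fun c : ZMod 9 => ζ ^ c.val) h
  have := ((z₉_spec L).embeddingsEquivPrimitiveRoots ℂ irreducible_cyclotomic_nine).injective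
    (a₁ := σ.toRatAlgHom) (a₂ := σ'.toRatAlgHom)
    (Subtype.ext (by simpa [RingHom.toRatAlgHom_apply] using hz))
  rw [← RingHom.toRatAlgHom_toRingHom σ, ← RingHom.toRatAlgHom_toRingHom σ', this]

/-- The exponent of an embedding of `ℚ(ζ₉)` is prime to `9`. [folklore] -/
private theorem coprime_exp₉ (σ : L →+* ℂ) : (exp₉ L σ).val.Coprime 9 := by
  have hprim : IsPrimitiveRoot (σ (z₉ L)) 9 := (z₉_spec L).map_of_injective σ.injective
  rw [exp₉_spec L σ] at hprim
  exact (isPrimitiveRoot_ζ.pow_iff_coprime (by norm_num) _).1 hprim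

/-- Every exponent prime to `9` is the exponent of some embedding of `ℚ(ζ₉)`. [folklore] -/
private theorem exists_exp₉_eq (c : ZMod 9) (hc : c.val.Coprime 9) : ∃ σ : L →+* ℂ, exp₉ L σ = c := by
  have hmem : ζ ^ c.val ∈ primitiveRoots 9 ℂ :=
    (mem_primitiveRoots (by norm_num)).2 (isPrimitiveRoot_ζ.pow_of_coprime c.val hc)
  let φ : L →ₐ[ℚ] ℂ := ((z₉_spec L).embeddingsEquivPrimitiveRoots ℂ irreducible_cyclotomic_nine).symm ⟨_, hmem⟩
  refine ⟨φ.toRingHom, exp₉_eq_of_apply_eq L ?_⟩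
  have h := (z₉_spec L).embeddingsEquivPrimitiveRoots_apply_coe ℂ irreducible_cyclotomic_nine φ
  simp only [φ, Equiv.apply_symm_apply] at h
  exact h.symm

/-- `[ℚ(ζ₉) : ℚ] = φ(9) = 6`. [folklore] -/
private theorem finrank_nine : Module.finrank ℚ L = 6 := by
  rw [IsCyclotomicExtension.finrank (n := 9) L irreducible_cyclotomic_nine]; decide

/-- `ℚ(ζ₉)` is a CM field (Mathlib: nontrivial cyclotomic fields are CM). [folklore] -/
private theorem isCMField_nine : IsCMField L := IsCyclotomicExtension.Rat.isCMField L (S := {9}) ⟨9, rfl, by norm_num⟩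

/-- The set of exponents `{1, 2, 4} ⊂ (ℤ/9)ˣ` of the CM type `Φ₉` (a set of representatives of
`(ℤ/9)ˣ / {±1}`, so that `Φ₉ ⊔ Φ̄₉ = Hom(ℚ(ζ₉), ℂ)`; it is primitive: no `u ≠ 1` has `u · {1,2,4} = {1,2,4}`).
[folklore] -/
def P₉ : Finset (ZMod 9) := {1, 2, 4}

open Literature.AlgebraicGeometry.Motives (CMType)

/-- **The CM type `Φ₉ = {σ_1, σ_2, σ_4}` of `ℚ(ζ₉)`** (`σ_a : ζ₉ ↦ ζ^a`): a primitive CM type (its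
translates by `(ℤ/9)ˣ` are pairwise distinct). [folklore] -/
def Φ₉ : CMType L :=
  ⟨{σ | exp₉ L σ ∈ P₉}, fun σ => by
    simp only [Set.mem_setOf_eq]
    rw [exp₉_conjugate]
    have key : ∀ c : ZMod 9, c.val.Coprime 9 → (c ∈ P₉ ↔ -c ∉ P₉) := by decide
    exact key _ (coprime_exp₉ L σ)⟩

/-- Membership in `Φ₉` is read on the exponent. [folklore] -/
private theorem mem_Φ₉_iff (σ : L →+* ℂ) : σ ∈ (Φ₉ L).1 ↔ exp₉ L σ ∈ P₉ := Iff.rfl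

end Nine

section Three

variable (L : Type) [Field L] [NumberField L] [IsCyclotomicExtension {3} ℚ L]

/-- The generator `ζ₃ ∈ L = ℚ(ζ₃)` (Mathlib's `IsCyclotomicExtension.zeta`). [folklore] -/
abbrev z₃ : L := IsCyclotomicExtension.zeta 3 ℚ L

/-- `ζ₃` is a primitive cube root of unity. [folklore] -/
private theorem z₃_spec : IsPrimitiveRoot (z₃ L) 3 := IsCyclotomicExtension.zeta_spec 3 ℚ L

/-- `ζ₃⁹ = 1`. [folklore] -/
private theorem z₃_pow : z₃ L ^ 9 = 1 := by
  rw [show 9 = 3 * 3 by norm_num, pow_mul, (z₃_spec L).pow_eq_one, one_pow]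

/-- The exponent (in `ℤ/9`, relative to `ζ`) of an embedding `σ` of `L = ℚ(ζ₃)`: `σ ζ₃ = ζ^{e(σ)}`,
`e(σ) ∈ {3, 6}`. [folklore] -/
def exp₃ (σ : L →+* ℂ) : ZMod 9 := embExp (z₃_pow L) σ

/-- `σ ζ₃ = ζ^{e(σ)}`. [folklore] -/
private theorem exp₃_spec (σ : L →+* ℂ) : σ (z₃ L) = ζ ^ (exp₃ L σ).val := embExp_spec (z₃_pow L) σ

/-- The exponent of an embedding of `ℚ(ζ₃)` is determined by the image of `ζ₃`. [folklore] -/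
private theorem exp₃_eq_of_apply_eq {σ : L →+* ℂ} {c : ZMod 9} (h : σ (z₃ L) = ζ ^ c.val) : exp₃ L σ = c :=
  embExp_eq_of_apply_eq (z₃_pow L) h

/-- `e(τ ∘ σ) = u(τ) e(σ)` — the SAME exponent `u(τ)` as for `ℚ(ζ₉)`, since `ζ₃ ↦ ζ³` or `ζ⁶`, powers
of the one `ζ ∈ ℂ`. [folklore] -/
private theorem exp₃_comp (τ : ℂ ≃+* ℂ) (σ : L →+* ℂ) : exp₃ L ((τ : ℂ →+* ℂ).comp σ) = autExp τ * exp₃ L σ :=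
  embExp_comp (z₃_pow L) τ σ

/-- `e(σ̄) = -e(σ)`. [folklore] -/
private theorem exp₃_conjugate (σ : L →+* ℂ) : exp₃ L (ComplexEmbedding.conjugate σ) = - exp₃ L σ :=
  embExp_conjugate (z₃_pow L) σ

/-- The third cyclotomic polynomial is irreducible over `ℚ`. [folklore] -/
private theorem irreducible_cyclotomic_three : Irreducible (cyclotomic 3 ℚ) := cyclotomic.irreducible_rat (by norm_num)

/-- Embeddings of `ℚ(ζ₃)` are determined by their exponent. [folklore] -/
private theorem exp₃_injective : Function.Injective (exp₃ L) := by
  intro σ σ' h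
  have hz : σ (z₃ L) = σ' (z₃ L) := by
    rw [exp₃_spec L σ, exp₃_spec L σ']
    exact congrArg (fun c : ZMod 9 => ζ ^ c.val) h
  have := ((z₃_spec L).embeddingsEquivPrimitiveRoots ℂ irreducible_cyclotomic_three).injective
    (a₁ := σ.toRatAlgHom) (a₂ := σ'.toRatAlgHom)
    (Subtype.ext (by simpa [RingHom.toRatAlgHom_apply] using hz))
  rw [← RingHom.toRatAlgHom_toRingHom σ, ← RingHom.toRatAlgHom_toRingHom σ', this]

/-- `ζ³` is a primitive cube root of unity. [folklore] -/
private theorem isPrimitiveRoot_ζ_pow_three : IsPrimitiveRoot (ζ ^ 3) 3 :=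
  isPrimitiveRoot_ζ.pow (by norm_num) (by norm_num)

/-- The exponent of an embedding of `ℚ(ζ₃)` is `3` or `6`. [folklore] -/
private theorem exp₃_mem (σ : L →+* ℂ) : exp₃ L σ ∈ ({3, 6} : Finset (ZMod 9)) := by
  have hprim : IsPrimitiveRoot (σ (z₃ L)) 3 := (z₃_spec L).map_of_injective σ.injective
  obtain ⟨i, hi, hic, hζi⟩ := (isPrimitiveRoot_ζ_pow_three.isPrimitiveRoot_iff).1 hprim
  have hval : exp₃ L σ = ((3 * i : ℕ) : ZMod 9) :=
    exp₃_eq_of_apply_eq L (by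
      rw [← hζi, ← pow_mul, ZMod.val_natCast, ← pow_eq_pow_mod _ ζ_pow_nine])
  rw [hval]
  interval_cases i
  · exact absurd hic (by decide)
  · decide
  · decide

/-- Both exponents `3`, `6` occur. [folklore] -/
private theorem exists_exp₃_eq (c : ZMod 9) (hc : c ∈ ({3, 6} : Finset (ZMod 9))) : ∃ σ : L →+* ℂ, exp₃ L σ = c := by
  have hc' : ∃ i, i.Coprime 3 ∧ c = ((3 * i : ℕ) : ZMod 9) := by
    simp only [Finset.mem_insert, Finset.mem_singleton] at hc
    rcases hc with rfl | rfl
    · exact ⟨1, by decide, by decide⟩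
    · exact ⟨2, by decide, by decide⟩
  obtain ⟨i, hic, rfl⟩ := hc'
  have hmem : (ζ ^ 3) ^ i ∈ primitiveRoots 3 ℂ :=
    (mem_primitiveRoots (by norm_num)).2 (isPrimitiveRoot_ζ_pow_three.pow_of_coprime i hic)
  let φ : L →ₐ[ℚ] ℂ := ((z₃_spec L).embeddingsEquivPrimitiveRoots ℂ irreducible_cyclotomic_three).symm ⟨_, hmem⟩
  refine ⟨φ.toRingHom, exp₃_eq_of_apply_eq L ?_⟩
  have h := (z₃_spec L).embeddingsEquivPrimitiveRoots_apply_coe ℂ irreducible_cyclotomic_three φ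
  simp only [φ, Equiv.apply_symm_apply] at h
  rw [AlgHom.toRingHom_eq_coe, RingHom.coe_coe, ← h, ← pow_mul, ZMod.val_natCast,
    ← pow_eq_pow_mod _ ζ_pow_nine]

/-- `[ℚ(ζ₃) : ℚ] = φ(3) = 2`. [folklore] -/
private theorem finrank_three : Module.finrank ℚ L = 2 := by
  rw [IsCyclotomicExtension.finrank (n := 3) L irreducible_cyclotomic_three]; decide

/-- `ℚ(ζ₃) = ℚ(√-3)` is a CM field. [folklore] -/
private theorem isCMField_three : IsCMField L := IsCyclotomicExtension.Rat.isCMField L (S := {3}) ⟨3, rfl, by norm_num⟩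

open Literature.AlgebraicGeometry.Motives (CMType)

/-- **The CM type `Φ₃ = {ῑ}` of `ℚ(ζ₃)`**, `ῑ : ζ₃ ↦ ζ⁶ = \bar{ζ³}` (the conjugate embedding).
[folklore] -/
def Φ₃ : CMType L :=
  ⟨{σ | exp₃ L σ = 6}, fun σ => by
    simp only [Set.mem_setOf_eq]
    rw [exp₃_conjugate]
    have key : ∀ c : ZMod 9, c ∈ ({3, 6} : Finset (ZMod 9)) → (c = 6 ↔ ¬ (-c = 6)) := by decide
    exact key _ (exp₃_mem L σ)⟩

/-- Membership in `Φ₃` is read on the exponent. [folklore] -/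
private theorem mem_Φ₃_iff (σ : L →+* ℂ) : σ ∈ (Φ₃ L).1 ↔ exp₃ L σ = 6 := Iff.rfl

end Three


/-! ### §4 The combinatorial model `ℤ/9 ⊔ (Fin m × ℤ/9)` and the witness weight -/

section Model

variable {m : ℕ}

/-- The model of the index set `⊔_i Hom(K_i, ℂ)` of the family `(ℚ(ζ₉), ℚ(ζ₃), …, ℚ(ζ₃))` (`m` copies
of `ℚ(ζ₃)`): an embedding of block `0` is recorded by its exponent `a ∈ (ℤ/9)ˣ`, an embedding of block
`j + 1` by `(j, c)` with its exponent `c ∈ {3, 6}`. [folklore] -/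
abbrev Model (m : ℕ) : Type := ZMod 9 ⊕ (Fin m × ZMod 9)

/-- The action of `Aut(ℂ)` on the model through the exponent `u(τ)`: multiplication by `u`. [folklore] -/
def act (u : ZMod 9) : Model m → Model m := Sum.map (u * ·) (Prod.map id (u * ·))

/-- The action on block `0`. [folklore] -/
@[simp] private theorem act_inl (u a : ZMod 9) : act (m := m) u (Sum.inl a) = Sum.inl (u * a) := rfl

/-- The action on the blocks `j + 1`. [folklore] -/
@[simp] private theorem act_inr (u : ZMod 9) (j : Fin m) (c : ZMod 9) :
    act u (Sum.inr (j, c)) = Sum.inr (j, u * c) := rfl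

/-- Membership in the CM type, read in the model: exponent in `{1,2,4}` on block `0`, exponent `6` on the
other blocks. [folklore] -/
def InΦ : Model m → Prop
  | Sum.inl a => a ∈ P₉
  | Sum.inr p => p.2 = 6

/-- `InΦ` is decidable (finite data). [folklore] -/
instance instDecidablePredInΦ : DecidablePred (InΦ (m := m))
  | Sum.inl a => inferInstanceAs (Decidable (a ∈ P₉))
  | Sum.inr p => inferInstanceAs (Decidable (p.2 = 6))

/-- `InΦ` on block `0`: exponent in `{1, 2, 4}`. [folklore] -/
@[simp] private theorem inΦ_inl (a : ZMod 9) : InΦ (m := m) (Sum.inl a) ↔ a ∈ P₉ := Iff.rfl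

/-- `InΦ` on the blocks `j + 1`: exponent `6`. [folklore] -/
@[simp] private theorem inΦ_inr (p : Fin m × ZMod 9) : InΦ (Sum.inr p) ↔ p.2 = 6 := Iff.rfl

/-- The exponents `{1, 4, 7} = {u ∈ (ℤ/9)ˣ | u ≡ 1 (mod 3)}`: the embeddings of `ℚ(ζ₉)` restricting to the
embedding `ζ₃ ↦ ζ³` of `ℚ(ζ₃) ⊂ ℚ(ζ₉)` — the block-`0` part of the Weil weight. [folklore] -/
def coreL : Finset (ZMod 9) := {1, 4, 7}

/-- The exponents `{3, 6}` of the two embeddings `ζ₃ ↦ ζ³, ζ⁶` of `ℚ(ζ₃)`. [folklore] -/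
def padL : Finset (ZMod 9) := {3, 6}

/-- The exponents `1, 4, 7` are prime to `9`. [folklore] -/
private theorem coprime_of_mem_coreL {u : ZMod 9} (hu : u ∈ coreL) : u.val.Coprime 9 := by
  revert u; decide

/-- `3 ∈ {3, 6}`. [folklore] -/
private theorem three_mem_padL : (3 : ZMod 9) ∈ padL := by decide

/-- `Sum.inl : ℤ/9 ↪ Model m` as an embedding (block `0`). [folklore] -/
def inlEmb : ZMod 9 ↪ Model m := ⟨Sum.inl, Sum.inl_injective⟩

/-- `Sum.inr : Fin m × ℤ/9 ↪ Model m` as an embedding (blocks `1, …, m`). [folklore] -/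
def inrEmb : Fin m × ZMod 9 ↪ Model m := ⟨Sum.inr, Sum.inr_injective⟩

/-- Unfolding of `inlEmb`. [folklore] -/
@[simp] private theorem inlEmb_apply (a : ZMod 9) : (inlEmb (m := m)) a = Sum.inl a := rfl

/-- Unfolding of `inrEmb`. [folklore] -/
@[simp] private theorem inrEmb_apply (p : Fin m × ZMod 9) : inrEmb p = Sum.inr p := rfl

/-- **The model of the witness weight**: `{σ₁, σ₄, σ₇}` on block `0`, the embedding of exponent `3` of the
block `j₀ + 1`, and BOTH embeddings of each block `j + 1`, `j ∈ J` (`j₀ ∉ J`). [folklore] -/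
def modelSet (j₀ : Fin m) (J : Finset (Fin m)) : Finset (Model m) :=
  (coreL.map inlEmb ∪ {Sum.inr (j₀, 3)}) ∪ (J ×ˢ padL).map inrEmb

variable {j₀ : Fin m} {J : Finset (Fin m)}

/-- The three kinds of points of the model set. [folklore] -/
private theorem mem_modelSet_iff {y : Model m} : y ∈ modelSet j₀ J ↔
    (∃ a ∈ coreL, y = Sum.inl a) ∨ y = Sum.inr (j₀, 3) ∨ ∃ j ∈ J, ∃ c ∈ padL, y = Sum.inr (j, c) := by
  simp only [modelSet, Finset.mem_union, Finset.mem_map, inlEmb_apply, Finset.mem_singleton,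
    Finset.mem_product, inrEmb_apply, Prod.exists]
  constructor
  · rintro ((⟨a, ha, rfl⟩ | rfl) | ⟨j, c, ⟨hj, hc⟩, rfl⟩)
    · exact Or.inl ⟨a, ha, rfl⟩
    · exact Or.inr (Or.inl rfl)
    · exact Or.inr (Or.inr ⟨j, hj, c, hc, rfl⟩)
  · rintro (⟨a, ha, rfl⟩ | rfl | ⟨j, hj, c, hc, rfl⟩)
    · exact Or.inl (Or.inl ⟨a, ha, rfl⟩)
    · exact Or.inl (Or.inr rfl)
    · exact Or.inr ⟨j, c, ⟨hj, hc⟩, rfl⟩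

/-- The block-`0` part and the single point `(j₀, 3)` are disjoint. [folklore] -/
private theorem disjoint_core_single : Disjoint (coreL.map (inlEmb (m := m))) {Sum.inr (j₀, 3)} := by
  rw [Finset.disjoint_singleton_right]
  simp [Finset.mem_map]

/-- The core `{1,4,7} ⊔ {(j₀,3)}` is disjoint from the full blocks `J × {3,6}` when `j₀ ∉ J`. [folklore] -/
private theorem disjoint_core_pad (hJ : j₀ ∉ J) :
    Disjoint (coreL.map inlEmb ∪ {Sum.inr (j₀, 3)}) ((J ×ˢ padL).map (inrEmb (m := m))) := by
  rw [Finset.disjoint_left]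
  intro y hy hy'
  simp only [Finset.mem_union, Finset.mem_map, inlEmb_apply, Finset.mem_singleton, Finset.mem_product,
    inrEmb_apply, Prod.exists] at hy hy'
  obtain ⟨j, c, ⟨hj, -⟩, rfl⟩ := hy'
  rcases hy with ⟨a, -, h⟩ | h
  · exact Sum.inl_ne_inr h
  · simp only [Sum.inr.injEq, Prod.mk.injEq] at h
    exact hJ (h.1 ▸ hj)

/-- `|modelSet| = 3 + 1 + 2|J| = 2 (|J| + 2)`. [folklore] -/
private theorem card_modelSet (hJ : j₀ ∉ J) : (modelSet j₀ J).card = 2 * (J.card + 2) := by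
  rw [modelSet, Finset.card_union_of_disjoint (disjoint_core_pad hJ),
    Finset.card_union_of_disjoint disjoint_core_single, Finset.card_map, Finset.card_map,
    Finset.card_singleton, Finset.card_product, show coreL.card = 3 by decide, show padL.card = 2 by decide]
  ring

/-- **The count behind balancedness**: for every `u ∈ (ℤ/9)ˣ`, exactly half of `u · modelSet` lies in the
CM type (case `u ≡ 1 (3)`: `{u, 4u, 7u} ∩ {1,2,4}` has two elements and `3u = 3`; case `u ≡ 2 (3)`: one
element and `3u = 6`; each full block contributes one). [folklore] -/
private theorem card_filter_modelSet (hJ : j₀ ∉ J) (u : ZMod 9) (hu : u.val.Coprime 9) :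
    ((modelSet j₀ J).filter (fun y => InΦ (act u y))).card = J.card + 2 ∧
      ((modelSet j₀ J).filter (fun y => ¬ InΦ (act u y))).card = J.card + 2 := by
  have key : ∀ u : ZMod 9, u.val.Coprime 9 →
      ((coreL.filter (fun a => u * a ∈ P₉)).card + (if u * 3 = 6 then 1 else 0) = 2 ∧
        (padL.filter (fun c => u * c = 6)).card = 1) ∧
      ((coreL.filter (fun a => ¬ (u * a ∈ P₉))).card + (if ¬ (u * 3 = 6) then 1 else 0) = 2 ∧
        (padL.filter (fun c => ¬ (u * c = 6))).card = 1) := by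
    decide
  obtain ⟨⟨h1, h2⟩, ⟨h3, h4⟩⟩ := key u hu
  have split : ∀ (Q : Model m → Prop) [DecidablePred Q],
      ((modelSet j₀ J).filter Q).card =
        (coreL.filter (fun a => Q (Sum.inl a))).card + (if Q (Sum.inr (j₀, 3)) then 1 else 0) +
          ((J ×ˢ padL).filter (fun p => Q (Sum.inr p))).card := by
    intro Q _
    rw [modelSet, Finset.filter_union,
      Finset.card_union_of_disjoint (Finset.disjoint_filter_filter (disjoint_core_pad hJ)),
      Finset.filter_union, Finset.card_union_of_disjoint (Finset.disjoint_filter_filter disjoint_core_single),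
      Finset.filter_map, Finset.card_map, Finset.filter_map, Finset.card_map, Finset.filter_singleton]
    congr 1
    · congr 1
      split_ifs <;> simp
  constructor
  · rw [split]
    have hc : (coreL.filter (fun a => InΦ (m := m) (act u (Sum.inl a)))) = coreL.filter (fun a => u * a ∈ P₉) :=
      Finset.filter_congr fun a _ => Iff.rfl
    have hp : ((J ×ˢ padL).filter (fun p => InΦ (act u (Sum.inr p)))) = J ×ˢ padL.filter (fun c => u * c = 6) := by
      rw [← Finset.filter_product_right]
      exact Finset.filter_congr fun p _ => Iff.rfl
    rw [hc, hp, Finset.card_product, h2, mul_one]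
    have hi : (if InΦ (m := m) (act u (Sum.inr (j₀, 3))) then 1 else 0) = (if u * 3 = 6 then 1 else 0) :=
      if_congr Iff.rfl rfl rfl
    rw [hi]
    omega
  · rw [split]
    have hc : (coreL.filter (fun a => ¬ InΦ (m := m) (act u (Sum.inl a)))) =
        coreL.filter (fun a => ¬ (u * a ∈ P₉)) :=
      Finset.filter_congr fun a _ => Iff.rfl
    have hp : ((J ×ˢ padL).filter (fun p => ¬ InΦ (act u (Sum.inr p)))) =
        J ×ˢ padL.filter (fun c => ¬ (u * c = 6)) := by
      rw [← Finset.filter_product_right]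
      exact Finset.filter_congr fun p _ => Iff.rfl
    rw [hc, hp, Finset.card_product, h4, mul_one]
    have hi : (if ¬ InΦ (m := m) (act u (Sum.inr (j₀, 3))) then 1 else 0) = (if ¬ (u * 3 = 6) then 1 else 0) :=
      if_congr Iff.rfl rfl rfl
    rw [hi]
    omega

/-- **No balanced partner for `σ₁` inside the witness weight** (model form): no `y ≠ σ₁` of the model
set satisfies `u ∈ Φ₉ ↔ u·y ∉ Φ` for all three `u ∈ {1, 4, 7}`. [folklore] -/
private theorem no_partner_model {y : Model m} (hy : y ∈ modelSet j₀ J) (hy1 : y ≠ Sum.inl 1)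
    (h : ∀ u ∈ coreL, (u ∈ P₉ ↔ ¬ InΦ (act u y))) : False := by
  have keyl : ∀ a ∈ coreL, a ≠ 1 → ¬ ∀ u ∈ coreL, (u ∈ P₉ ↔ ¬ (u * a ∈ P₉)) := by decide
  have keyr : ∀ c ∈ padL, ¬ ∀ u ∈ coreL, (u ∈ P₉ ↔ ¬ (u * c = 6)) := by decide
  rcases mem_modelSet_iff.1 hy with ⟨a, ha, rfl⟩ | rfl | ⟨j, -, c, hc, rfl⟩
  · exact keyl a ha (fun h1 => hy1 (by rw [h1])) (fun u hu => by simpa using h u hu)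
  · exact keyr 3 three_mem_padL (fun u hu => by simpa using h u hu)
  · exact keyr c hc (fun u hu => by simpa using h u hu)

end Model

/-! ### §5 Exponent data on a family of CM fields and the transfer to the model -/

section Transfer

open Literature.AlgebraicGeometry.Motives (CMType)

variable {m : ℕ} {K : Fin (m + 1) → Type} [∀ i, Field (K i)]

/-- **Exponent data** for a family `K₀, K₁, …, K_m` of fields with CM types `Φ_i`: exponent maps
`e_i : Hom(K_i, ℂ) → ℤ/9` that are injective, `Aut(ℂ)`-equivariant for the exponent `u(τ)`, describe the
CM types (`Φ₀ = e₀⁻¹{1,2,4}`, `Φ_{j+1} = e_{j+1}⁻¹{6}`) and take the values `{1,4,7}` on block `0` and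
`{3,6}` on the other blocks — exactly what the family `(ℚ(ζ₉); Φ₉), (ℚ(ζ₃); Φ₃), …` provides
(`expData`). An internal device separating the combinatorics from the cyclotomic arithmetic. [folklore] -/
private structure ExpData (K : Fin (m + 1) → Type) [∀ i, Field (K i)] (Φ : ∀ i, CMType (K i)) where
  /-- the exponent maps -/
  e : ∀ i, (K i →+* ℂ) → ZMod 9
  e_injective : ∀ i, Function.Injective (e i)
  e_comp : ∀ i (τ : ℂ ≃+* ℂ) (σ : K i →+* ℂ), e i ((τ : ℂ →+* ℂ).comp σ) = autExp τ * e i σ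
  mem_iff_zero : ∀ σ : K 0 →+* ℂ, σ ∈ (Φ 0).1 ↔ e 0 σ ∈ P₉
  mem_iff_succ : ∀ (j : Fin m) (σ : K j.succ →+* ℂ), σ ∈ (Φ j.succ).1 ↔ e j.succ σ = 6
  exists_zero : ∀ c ∈ coreL, ∃ σ : K 0 →+* ℂ, e 0 σ = c
  exists_succ : ∀ (j : Fin m), ∀ c ∈ padL, ∃ σ : K j.succ →+* ℂ, e j.succ σ = c

variable {Φ : ∀ i, CMType (K i)} (D : ExpData K Φ)

/-- The model point of an embedding of the family. [folklore] -/
private def code (x : (i : Fin (m + 1)) × (K i →+* ℂ)) : Model m :=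
  Fin.cases (motive := fun i => (K i →+* ℂ) → Model m)
    (fun σ => Sum.inl (D.e 0 σ)) (fun j σ => Sum.inr (j, D.e j.succ σ)) x.1 x.2

/-- The code of an embedding of block `0` is its exponent. [folklore] -/
@[simp] private theorem code_zero (σ : K 0 →+* ℂ) : code D ⟨0, σ⟩ = Sum.inl (D.e 0 σ) := rfl

/-- The code of an embedding of block `j + 1` is `(j, exponent)`. [folklore] -/
@[simp] private theorem code_succ (j : Fin m) (σ : K j.succ →+* ℂ) :
    code D ⟨j.succ, σ⟩ = Sum.inr (j, D.e j.succ σ) := rfl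

/-- Embeddings of the family are determined by their code (block index and exponent). [folklore] -/
private theorem code_injective : Function.Injective (code D) := by
  rintro ⟨i, σ⟩ ⟨i', σ'⟩ h
  induction i using Fin.cases with
  | zero =>
    induction i' using Fin.cases with
    | zero =>
      rw [code_zero, code_zero, Sum.inl.injEq] at h
      rw [D.e_injective 0 h]
    | succ j' => exact absurd h (by rw [code_zero, code_succ]; exact Sum.inl_ne_inr)
  | succ j =>
    induction i' using Fin.cases with
    | zero => exact absurd h (by rw [code_zero, code_succ]; exact Sum.inr_ne_inl)
    | succ j' =>
      rw [code_succ, code_succ, Sum.inr.injEq, Prod.mk.injEq] at h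
      obtain ⟨rfl, h2⟩ := h
      rw [D.e_injective _ h2]

/-- Equivariance: `code (τ ∘ σ) = u(τ) · code σ`. [folklore] -/
private theorem code_comp (τ : ℂ ≃+* ℂ) (i : Fin (m + 1)) (σ : K i →+* ℂ) :
    code D ⟨i, (τ : ℂ →+* ℂ).comp σ⟩ = act (autExp τ) (code D ⟨i, σ⟩) := by
  induction i using Fin.cases with
  | zero => rw [code_zero, code_zero, act_inl, D.e_comp]
  | succ j => rw [code_succ, code_succ, act_inr, D.e_comp]

/-- The CM types read in the model. [folklore] -/
private theorem mem_iff_inΦ (i : Fin (m + 1)) (σ : K i →+* ℂ) : σ ∈ (Φ i).1 ↔ InΦ (code D ⟨i, σ⟩) := by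
  induction i using Fin.cases with
  | zero => rw [code_zero, inΦ_inl]; exact D.mem_iff_zero σ
  | succ j => rw [code_succ, inΦ_inr]; exact D.mem_iff_succ j σ

variable [∀ i, NumberField (K i)]

/-- **The witness weight** `S ⊆ ⊔_i Hom(K_i, ℂ)`: the embeddings whose model point lies in `modelSet j₀ J`.
[folklore] -/
private def witnessSet (j₀ : Fin m) (J : Finset (Fin m)) : Finset ((i : Fin (m + 1)) × (K i →+* ℂ)) :=
  open scoped Classical in
  Finset.univ.filter (fun x => code D x ∈ modelSet j₀ J)

variable {j₀ : Fin m} {J : Finset (Fin m)}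

/-- Membership in the witness weight is read on the code. [folklore] -/
private theorem mem_witnessSet_iff {x : (i : Fin (m + 1)) × (K i →+* ℂ)} :
    x ∈ witnessSet D j₀ J ↔ code D x ∈ modelSet j₀ J := by
  classical
  simp [witnessSet]

omit [∀ i, NumberField (K i)] in
/-- Every model point of `modelSet` is the code of an embedding. [folklore] -/
private theorem modelSet_subset_range : ((modelSet j₀ J : Finset (Model m)) : Set (Model m)) ⊆ Set.range (code D) := by
  intro y hy
  rcases mem_modelSet_iff.1 (Finset.mem_coe.1 hy) with ⟨a, ha, rfl⟩ | rfl | ⟨j, -, c, hc, rfl⟩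
  · obtain ⟨σ, hσ⟩ := D.exists_zero a ha
    exact ⟨⟨0, σ⟩, by rw [code_zero, hσ]⟩
  · obtain ⟨σ, hσ⟩ := D.exists_succ j₀ 3 three_mem_padL
    exact ⟨⟨j₀.succ, σ⟩, by rw [code_succ, hσ]⟩
  · obtain ⟨σ, hσ⟩ := D.exists_succ j c hc
    exact ⟨⟨j.succ, σ⟩, by rw [code_succ, hσ]⟩

/-- **Transfer of counts to the model**: a condition on embeddings that only depends on the model point is
counted on `modelSet`. [folklore] -/
private theorem ncard_sep_witnessSet (Q : ((i : Fin (m + 1)) × (K i →+* ℂ)) → Prop) (Qm : Model m → Prop)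
    [DecidablePred Qm] (hQ : ∀ x, Q x ↔ Qm (code D x)) :
    {x | x ∈ witnessSet D j₀ J ∧ Q x}.ncard = ((modelSet j₀ J).filter Qm).card := by
  have hset : {x | x ∈ witnessSet D j₀ J ∧ Q x} =
      code D ⁻¹' (((modelSet j₀ J).filter Qm : Finset (Model m)) : Set (Model m)) := by
    ext x
    simp only [Set.mem_setOf_eq, mem_witnessSet_iff, hQ, Set.mem_preimage, Finset.coe_filter]
  rw [hset, Set.ncard_preimage_of_injective_subset_range (code_injective D), Set.ncard_coe_finset]
  intro y hy
  exact modelSet_subset_range D (Finset.mem_coe.2 (Finset.mem_filter.1 (Finset.mem_coe.1 hy)).1)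

/-- `|S| = 2 (|J| + 2)`. [folklore] -/
private theorem card_witnessSet (hJ : j₀ ∉ J) : (witnessSet D j₀ J).card = 2 * (J.card + 2) := by
  have h := ncard_sep_witnessSet D (j₀ := j₀) (J := J) (fun _ => True) (fun _ => True) (fun _ => Iff.rfl)
  rw [Finset.filter_true_of_mem (fun _ _ => trivial), card_modelSet hJ] at h
  rw [← h, ← Set.ncard_coe_finset]
  congr 1
  ext x
  simp

/-- **The witness weight is Galois balanced** (it indexes a Hodge class: Pohlmann's condition (9.2.1); for
`J = ∅` it is the weight of a Weil class of the Weil-type fourfold `A₉ × E`, van Geemen 4.10).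
[cite: Gordon1999HodgeAVSurvey, §9.2 (9.2.1)] [cite: vanGeemen1994HodgeAV, 4.9–4.10] -/
private theorem isGaloisBalancedAlg_witnessSet (hJ : j₀ ∉ J) : IsGaloisBalancedAlg Φ (witnessSet D j₀ J) := by
  intro τ
  have hQ : ∀ x : (i : Fin (m + 1)) × (K i →+* ℂ),
      (τ : ℂ →+* ℂ).comp x.2 ∈ (Φ x.1).1 ↔ InΦ (act (autExp τ) (code D x)) := fun x => by
    rw [mem_iff_inΦ D x.1, code_comp]
  have h1 := ncard_sep_witnessSet D (j₀ := j₀) (J := J) (fun x => (τ : ℂ →+* ℂ).comp x.2 ∈ (Φ x.1).1)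
    (fun y => InΦ (act (autExp τ) y)) hQ
  have h2 := ncard_sep_witnessSet D (j₀ := j₀) (J := J) (fun x => (τ : ℂ →+* ℂ).comp x.2 ∉ (Φ x.1).1)
    (fun y => ¬ InΦ (act (autExp τ) y)) (fun x => not_congr (hQ x))
  obtain ⟨c1, c2⟩ := card_filter_modelSet hJ (autExp τ) (coprime_autExp τ)
  exact h1.trans ((c1.trans c2.symm).trans h2.symm)

/-- The witness weight lies in `pohlmannSetsAlg Φ (|J| + 2)` (a balanced `2(|J|+2)`-set).
[cite: Gordon1999HodgeAVSurvey, §9.2 (9.2.1)] -/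
private theorem witnessSet_mem_pohlmannSetsAlg (hJ : j₀ ∉ J) : witnessSet D j₀ J ∈ pohlmannSetsAlg Φ (J.card + 2) :=
  ⟨card_witnessSet D hJ, isGaloisBalancedAlg_witnessSet D hJ⟩

/-- Every element of an `m`-fold disjoint union of members of `T` lies in a member of `T` contained in
the union. [folklore] -/
private theorem exists_mem_sub_of_mem_disjointUnionsOf {I : Type*} {T : Set (Finset I)} {k : ℕ} {u : Finset I}
    (hu : u ∈ disjointUnionsOf T k) : ∀ x ∈ u, ∃ t ∈ T, x ∈ t ∧ t ⊆ u := by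
  classical
  refine disjointUnionsOf_induction (T := T) (P := fun u => ∀ x ∈ u, ∃ t ∈ T, x ∈ t ∧ t ⊆ u) ?_ ?_ hu
  · intro x hx
    exact absurd hx (Finset.notMem_empty x)
  · intro s t hs ht hst x hx
    rw [Finset.disjUnion_eq_union] at hx ⊢
    rcases Finset.mem_union.1 hx with hx | hx
    · obtain ⟨t', ht', hxt', hsub⟩ := hs x hx
      exact ⟨t', ht', hxt', hsub.trans Finset.subset_union_left⟩
    · exact ⟨t, ht, hx, Finset.subset_union_right⟩

omit [∀ i, NumberField (K i)] in
/-- In a balanced PAIR `{a, b}`, for every `τ` exactly one of `τa`, `τb` lies in the CM type. [folklore] -/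
private theorem mem_iff_not_mem_of_balanced_pair [DecidableEq ((i : Fin (m + 1)) × (K i →+* ℂ))]
    {a b : (i : Fin (m + 1)) × (K i →+* ℂ)} (hab : a ≠ b)
    (ht : IsGaloisBalancedAlg Φ ({a, b} : Finset _)) (τ : ℂ ≃+* ℂ) :
    ((τ : ℂ →+* ℂ).comp a.2 ∈ (Φ a.1).1 ↔ (τ : ℂ →+* ℂ).comp b.2 ∉ (Φ b.1).1) := by
  have h := ht τ
  by_cases ha : (τ : ℂ →+* ℂ).comp a.2 ∈ (Φ a.1).1 <;>
    by_cases hb : (τ : ℂ →+* ℂ).comp b.2 ∈ (Φ b.1).1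
  · exfalso
    have h1 : {x : (i : Fin (m + 1)) × (K i →+* ℂ) |
        x ∈ ({a, b} : Finset _) ∧ (τ : ℂ →+* ℂ).comp x.2 ∈ (Φ x.1).1} = {a, b} := by
      ext x
      simp only [Finset.mem_insert, Finset.mem_singleton, Set.mem_setOf_eq, Set.mem_insert_iff]
      constructor
      · exact fun hx => hx.1
      · rintro (rfl | rfl)
        · exact ⟨Or.inl rfl, ha⟩
        · exact ⟨Or.inr rfl, hb⟩
    have h2 : {x : (i : Fin (m + 1)) × (K i →+* ℂ) |
        x ∈ ({a, b} : Finset _) ∧ (τ : ℂ →+* ℂ).comp x.2 ∉ (Φ x.1).1} = ∅ := by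
      ext x
      simp only [Finset.mem_insert, Finset.mem_singleton, Set.mem_setOf_eq, Set.mem_empty_iff_false,
        iff_false, not_and, not_not]
      rintro (rfl | rfl)
      · exact ha
      · exact hb
    rw [h1, h2, Set.ncard_pair hab, Set.ncard_empty] at h
    exact absurd h (by norm_num)
  · exact iff_of_true ha hb
  · exact iff_of_false ha (not_not.2 hb)
  · exfalso
    have h1 : {x : (i : Fin (m + 1)) × (K i →+* ℂ) |
        x ∈ ({a, b} : Finset _) ∧ (τ : ℂ →+* ℂ).comp x.2 ∈ (Φ x.1).1} = ∅ := by
      ext x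
      simp only [Finset.mem_insert, Finset.mem_singleton, Set.mem_setOf_eq, Set.mem_empty_iff_false,
        iff_false, not_and]
      rintro (rfl | rfl)
      · exact ha
      · exact hb
    have h2 : {x : (i : Fin (m + 1)) × (K i →+* ℂ) |
        x ∈ ({a, b} : Finset _) ∧ (τ : ℂ →+* ℂ).comp x.2 ∉ (Φ x.1).1} = {a, b} := by
      ext x
      simp only [Finset.mem_insert, Finset.mem_singleton, Set.mem_setOf_eq, Set.mem_insert_iff]
      constructor
      · exact fun hx => hx.1
      · rintro (rfl | rfl)
        · exact ⟨Or.inl rfl, ha⟩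
        · exact ⟨Or.inr rfl, hb⟩
    rw [h1, h2, Set.ncard_pair hab, Set.ncard_empty] at h
    exact absurd h (by norm_num)

/-- **The witness weight is not a disjoint union of balanced pairs** (`σ₁` has no balanced partner in
it: test with `τ ∈ Aut(ℂ)` of exponent `1`, `4`, `7`) — White's criterion 9.2.2 for an exceptional class; for
`J = ∅` this is `D²(A₉ × E) ≠ B²(A₉ × E)` (Moonen–Zarhin, Thm. 0.1, case (a) and the remark following it).
[cite: Gordon1999HodgeAVSurvey, 9.2.2] [cite: MoonenZarhin1999LowDim, Thm. 0.1 (a)] -/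
private theorem witnessSet_not_mem_pohlmannDivisorSetsAlg (p : ℕ) :
    witnessSet D j₀ J ∉ pohlmannDivisorSetsAlg Φ p := by
  classical
  intro hS
  obtain ⟨σ₁, hσ₁⟩ := D.exists_zero 1 (by decide)
  have hx₀ : (⟨0, σ₁⟩ : (i : Fin (m + 1)) × (K i →+* ℂ)) ∈ witnessSet D j₀ J := by
    rw [mem_witnessSet_iff, code_zero, hσ₁, mem_modelSet_iff]
    exact Or.inl ⟨1, by decide, rfl⟩
  obtain ⟨t, ht, hx₀t, htS⟩ := exists_mem_sub_of_mem_disjointUnionsOf hS _ hx₀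
  obtain ⟨a, b, hab, rfl⟩ := Finset.card_eq_two.1 ht.1
  -- the partner `y` of `x₀ = ⟨0, σ₁⟩` in the balanced pair `t = {a, b}`
  have key : ∀ y : (i : Fin (m + 1)) × (K i →+* ℂ), y ≠ ⟨0, σ₁⟩ → y ∈ witnessSet D j₀ J →
      (∀ τ : ℂ ≃+* ℂ, ((τ : ℂ →+* ℂ).comp σ₁ ∈ (Φ 0).1 ↔ (τ : ℂ →+* ℂ).comp y.2 ∉ (Φ y.1).1)) → False := by
    intro y hy hyS hτ
    refine no_partner_model (mem_witnessSet_iff D |>.1 hyS) (fun h => hy ?_) (fun u hu => ?_)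
    · apply code_injective D
      rw [h, code_zero, hσ₁]
    · obtain ⟨τ, rfl⟩ := exists_autExp_eq u (coprime_of_mem_coreL hu)
      have h := hτ τ
      rw [mem_iff_inΦ D 0, mem_iff_inΦ D y.1, code_comp, code_comp, code_zero, hσ₁, act_inl, mul_one,
        inΦ_inl] at h
      exact h
  rcases Finset.mem_insert.1 hx₀t with hx₀a | hx₀b
  · subst hx₀a
    exact key b hab.symm (htS (by simp)) (fun τ => mem_iff_not_mem_of_balanced_pair hab ht.2 τ)
  · rw [Finset.mem_singleton] at hx₀b
    subst hx₀b
    exact key a hab (htS (by simp)) (fun τ => iff_not_comm.1 (mem_iff_not_mem_of_balanced_pair hab ht.2 τ))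

end Transfer

/-! ### §6 The family `(ℚ(ζ₉); Φ₉) ⊔ (ℚ(ζ₃); Φ₃)^m`, its realisations and the barrier fact -/

section Family

open Literature.AlgebraicGeometry.Motives (CMType AbelianVariety IsSmoothProjective)
open Literature.AlgebraicGeometry.HodgeTheory
open Literature.AlgebraicGeometry.ComplexMultiplication (IsCMTypeRealisation)
open CategoryTheory CategoryTheory.Limits

variable (L₉ L₃ : Type) [Field L₉] [NumberField L₉] [IsCyclotomicExtension {9} ℚ L₉]
  [Field L₃] [NumberField L₃] [IsCyclotomicExtension {3} ℚ L₃]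

/-- The block fields of the witness family: block `0` is `L₉ = ℚ(ζ₉)`, the `m` further blocks are
`L₃ = ℚ(ζ₃)` (`Fin.cons`, so that `Kfam 0` and `Kfam j.succ` reduce definitionally). [folklore] -/
def Kfam (m : ℕ) : Fin (m + 1) → Type := Fin.cons L₉ (fun _ : Fin m => L₃)

/-- The field structures of the blocks (those of `L₉`, `L₃`). [folklore] -/
instance Kfam.instField (m : ℕ) : ∀ i, Field (Kfam L₉ L₃ m i) :=
  Fin.cases ‹Field L₉› (fun _ => ‹Field L₃›)

/-- The blocks are number fields. [folklore] -/
instance Kfam.instNumberField (m : ℕ) : ∀ i, NumberField (Kfam L₉ L₃ m i) :=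
  Fin.cases ‹NumberField L₉› (fun _ => ‹NumberField L₃›)

/-- The CM types of the family: `Φ₉` on block `0`, `Φ₃` on the others. [folklore] -/
def Φfam (m : ℕ) : ∀ i, CMType (Kfam L₉ L₃ m i) := Fin.cases (Φ₉ L₉) (fun _ => Φ₃ L₃)

/-- The exponent maps of the family: `exp₉` on block `0`, `exp₃` on the others. [folklore] -/
def efam (m : ℕ) : ∀ i, (Kfam L₉ L₃ m i →+* ℂ) → ZMod 9 := Fin.cases (exp₉ L₉) (fun _ => exp₃ L₃)

/-- The exponent data of the family `(ℚ(ζ₉); Φ₉), (ℚ(ζ₃); Φ₃), …` (all from §2–§3). [folklore] -/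
private def expData (m : ℕ) : ExpData (Kfam L₉ L₃ m) (Φfam L₉ L₃ m) where
  e := efam L₉ L₃ m
  e_injective := Fin.cases (exp₉_injective L₉) (fun _ => exp₃_injective L₃)
  e_comp := Fin.cases (exp₉_comp L₉) (fun _ => exp₃_comp L₃)
  mem_iff_zero := fun _ => Iff.rfl
  mem_iff_succ := fun _ _ => Iff.rfl
  exists_zero := fun c hc => exists_exp₉_eq L₉ c (coprime_of_mem_coreL hc)
  exists_succ := fun _ c hc => exists_exp₃_eq L₃ c hc

variable {L₉ L₃}
variable (A₉ A₃ : AbelianVariety ℂ)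

/-- The realisations of the family: `A₉` on block `0`, the same `E = A₃` on every other block. [folklore] -/
def Afam (m : ℕ) : Fin (m + 1) → AbelianVariety ℂ := Fin.cases A₉ (fun _ => A₃)

variable {A₉ A₃}
variable (ι₉ : 𝓞 L₉ →+* End A₉) (ι₃ : 𝓞 L₃ →+* End A₃)

/-- The `𝓞`-actions of the family. [folklore] -/
def ιfam (m : ℕ) : ∀ i, 𝓞 (Kfam L₉ L₃ m i) →+* End (Afam A₉ A₃ m i) := Fin.cases ι₉ (fun _ => ι₃)

variable (θ₉ : L₉ →+* Module.End ℂ (complexBetti A₉.X 1)) (θ₃ : L₃ →+* Module.End ℂ (complexBetti A₃.X 1))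

/-- The actions on `H¹` of the family. [folklore] -/
def θfam (m : ℕ) : ∀ i, Kfam L₉ L₃ m i →+* Module.End ℂ (complexBetti (Afam A₉ A₃ m i).X 1) :=
  Fin.cases θ₉ (fun _ => θ₃)

variable {ι₉ ι₃ θ₉ θ₃}

/-- Each block of the family is a realisation of its CM type. [folklore] -/
private theorem isCMTypeRealisation_fam (h₉ : IsCMTypeRealisation (Φ₉ L₉) A₉ ι₉ θ₉)
    (h₃ : IsCMTypeRealisation (Φ₃ L₃) A₃ ι₃ θ₃) (m : ℕ) :
    ∀ i, IsCMTypeRealisation (Φfam L₉ L₃ m i) (Afam A₉ A₃ m i) (ιfam ι₉ ι₃ m i) (θfam θ₉ θ₃ m i) :=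
  Fin.cases h₉ (fun _ => h₃)

/-! #### Dimension of a finite biproduct of abelian varieties (private copies of standard bookkeeping) -/

open Literature.AlgebraicGeometry.Motives.AbelianVariety in
/-- A biproduct indexed by `Fin 0` has dimension `0` (its identity is `0`, which is not an isogeny in
positive dimension). [cite: MumfordAV1970, §19] -/
private theorem dim_biproduct_fin_zero' (f : Fin 0 → AbelianVariety ℂ) : (⨁ f).dim = 0 := by
  by_contra h
  have hid : (𝟙 (⨁ f) : ⨁ f ⟶ ⨁ f) = 0 := biproduct.hom_ext _ _ fun j => Fin.elim0 j
  exact not_isIsogeny_zero_of_dim_pos (Nat.pos_of_ne_zero h) (hid ▸ isIsogeny_id (⨁ f))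

open Literature.AlgebraicGeometry.Motives.AbelianVariety in
/-- The comparison isomorphism `⨁_{Fin (m+1)} f ≅ f 0 × ⨁_{Fin m} (f ∘ succ)`. [cite: MumfordAV1970, §19] -/
private theorem biproduct_succ_split' {m : ℕ} (f : Fin (m + 1) → AbelianVariety ℂ) :
    ∃ (h : (⨁ f) ⟶ (f 0).prod (⨁ (f ∘ Fin.succ))) (g : (f 0).prod (⨁ (f ∘ Fin.succ)) ⟶ ⨁ f),
      h ≫ g = 𝟙 _ ∧ g ≫ h = 𝟙 _ := by
  refine ⟨prodLift (biproduct.π f 0) (biproduct.lift fun i => biproduct.π f i.succ),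
    biproduct.lift fun j => Fin.cases (fst _ _) (fun i => snd _ _ ≫ biproduct.π (f ∘ Fin.succ) i) j,
    ?_, ?_⟩
  · refine biproduct.hom_ext _ _ fun j => ?_
    rw [Category.assoc, biproduct.lift_π, Category.id_comp]
    refine Fin.cases ?_ (fun i => ?_) j
    · exact prodLift_fst _ _
    · change prodLift _ _ ≫ snd _ _ ≫ biproduct.π (f ∘ Fin.succ) i = biproduct.π f i.succ
      rw [← Category.assoc, prodLift_snd, biproduct.lift_π]
  · refine prod_hom_ext (by rw [Category.assoc, prodLift_fst, biproduct.lift_π, Category.id_comp]; rfl) ?_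
    rw [Category.assoc, prodLift_snd, Category.id_comp]
    refine biproduct.hom_ext _ _ fun i => ?_
    rw [Category.assoc, biproduct.lift_π]
    exact biproduct.lift_π _ _

open Literature.AlgebraicGeometry.Motives.AbelianVariety in
/-- `dim (⨁_{Fin m} f) = Σ_i dim (f i)` (Mumford §19; Görtz–Wedhorn I, Lemma 6.26, iterated along
`⨁_{Fin (m+1)} f ≅ f 0 × ⨁_{Fin m} (f ∘ succ)`). [cite: MumfordAV1970, §19] [cite: GortzWedhorn2020, Lemma 6.26] -/
private theorem dim_biproduct_fin' {m : ℕ} : ∀ (f : Fin m → AbelianVariety ℂ), (⨁ f).dim = ∑ i, (f i).dim := by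
  induction m with
  | zero =>
    intro f
    rw [dim_biproduct_fin_zero', Finset.univ_eq_empty, Finset.sum_empty]
  | succ m ih =>
    intro f
    obtain ⟨h, g, hhg, hgh⟩ := biproduct_succ_split' f
    have hh : IsIsogeny h :=
      isIsogeny_of_comp_eq_of_comp_eq (isIsogeny_id _) (isIsogeny_id _) hgh hhg
    rw [dim_eq_of_isIsogeny hh, dim_prod, ih (f ∘ Fin.succ), Fin.sum_univ_succ]
    rfl

/-- `dim A₉ = 3` and `dim E = 1` for realisations of `(ℚ(ζ₉); Φ₉)`, `(ℚ(ζ₃); Φ₃)` (`2 dim A = [K:ℚ]`,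
Shimura §6.2 Thm. 3); hence `dim (A₉ × E^m) = 3 + m`. [cite: Shimura1998, §6.2 Theorem 3] [cite: MumfordAV1970, §19] -/
theorem dim_biproduct_Afam (h₉ : IsCMTypeRealisation (Φ₉ L₉) A₉ ι₉ θ₉)
    (h₃ : IsCMTypeRealisation (Φ₃ L₃) A₃ ι₃ θ₃) (m : ℕ) : (⨁ Afam A₉ A₃ m).dim = 3 + m := by
  have h9 : A₉.dim = 3 := by
    have := Motives.schemeDim_eq_holds h₉.1
    rw [finrank_nine L₉] at this
    exact this
  have h3 : A₃.dim = 1 := by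
    have := Motives.schemeDim_eq_holds h₃.1
    rw [finrank_three L₃] at this
    exact this
  rw [dim_biproduct_fin', Fin.sum_univ_succ]
  simp only [Afam, Fin.cases_zero, Fin.cases_succ, Finset.sum_const, Finset.card_univ, Fintype.card_fin,
    smul_eq_mul, h9, h3, mul_one]

/-- **An exceptional Hodge class on `A₉ × E^{2k+1}`** (a CM abelian variety of dimension `2k + 4`, of
Weil type for `ℚ(ζ₃) = ℚ(√-3)`): a rational `(k+2, k+2)`-class in `H^{2k+4}` outside `D^{k+2} ⊗ ℂ`, by
Pohlmann's criterion `exists_exceptional_biproduct_iff` at the witness weight. [cite: vanGeemen1994HodgeAV, Thm. 4.11 and 4.7]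
[cite: Gordon1999HodgeAVSurvey, 9.2.2] [cite: Pohlmann1968, §3] -/
theorem exists_exceptional_fam (h₉ : IsCMTypeRealisation (Φ₉ L₉) A₉ ι₉ θ₉)
    (h₃ : IsCMTypeRealisation (Φ₃ L₃) A₃ ι₃ θ₃) (k : ℕ) :
    ∃ c : complexBetti (⨁ Afam A₉ A₃ (2 * k + 1)).X (2 * (k + 2)),
      IsRationalClass c ∧
        IsOfHodgeType (⨁ Afam A₉ A₃ (2 * k + 1)).dim (⨁ Afam A₉ A₃ (2 * k + 1)).X (2 * (k + 2)) (k + 2) (k + 2) c ∧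
        c ∉ Literature.Barriers.HodgeConjecture.divisorClassesSpan (⨁ Afam A₉ A₃ (2 * k + 1)).X
          (⨁ Afam A₉ A₃ (2 * k + 1)).dim (k + 2) := by
  have hA := isCMTypeRealisation_fam h₉ h₃ (2 * k + 1)
  let j₀ : Fin (2 * k + 1) := ⟨0, by omega⟩
  let J : Finset (Fin (2 * k + 1)) :=
    Finset.univ.map ⟨fun i : Fin k => (⟨i.val + 1, by omega⟩ : Fin (2 * k + 1)), fun a b h => by
      simp only [Fin.mk.injEq, add_left_inj] at h
      exact Fin.ext h⟩
  have hJ : j₀ ∉ J := by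
    simp only [J, j₀, Finset.mem_map, Finset.mem_univ, Function.Embedding.coeFn_mk, true_and, not_exists]
    intro i h
    have := congrArg Fin.val h
    simp at this
  have hcard : J.card = k := by
    rw [Finset.card_map, Finset.card_univ, Fintype.card_fin]
  refine (exists_exceptional_biproduct_iff hA (k + 2)).2
    ⟨witnessSet (expData L₉ L₃ (2 * k + 1)) j₀ J, ?_,
      witnessSet_not_mem_pohlmannDivisorSetsAlg (expData L₉ L₃ (2 * k + 1)) (k + 2)⟩
  have h := witnessSet_mem_pohlmannSetsAlg (expData L₉ L₃ (2 * k + 1)) hJ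
  rwa [hcard] at h

end Family

/-! ### §7 The barrier fact from the existence record -/

open Literature.AlgebraicGeometry.Motives (AbelianVariety)
open CategoryTheory CategoryTheory.Limits in
/-- **Weil's exceptional Hodge classes (van Geemen 1994, Thm. 4.11; Weil 1977) on CM abelian varieties of
Weil type, DERIVED from the existence of CM abelian varieties of prescribed CM type** (Shimura 1998, §6.2
Thm. 3 — the tree's record `PicardCM.CMAbelianVarietyRealised`): for every `n ≥ 2` the abelian `2n`-fold
`A₉ × E^{2n-3}` — `A₉` of CM type `(ℚ(ζ₉); {σ₁, σ₂, σ₄})`, `E` an elliptic curve with CM by `ℤ[ζ₃]` — carries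
a rational `(n, n)`-class outside the ring of divisor classes: the Weil class of weight
`{σ₁, σ₄, σ₇} ⊔ {ι} ⊔ (n - 2 blocks)` attached to the imaginary quadratic field `ℚ(ζ₃) ⊂ ℚ(ζ₉)` acting with
multiplicities `(n, n)` (Mumford–Pohlmann's mechanism, "the imaginary quadratic field is responsible",
van Geemen 4.7; Pohlmann's criterion, Gordon 9.2.2), which is Galois balanced but admits no balanced pair
through `σ₁`. [cite: vanGeemen1994HodgeAV, Thm. 4.11, 4.7, §2.5] [cite: Pohlmann1968, Thm. 1 and §3]
[cite: Gordon1999HodgeAVSurvey, §9.2 and 9.2.2] [cite: Shimura1998, §6.2 Theorem 3] -/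
theorem weil1977_exceptionalHodgeClasses_of_cmAbelianVarietyRealised
    (hreal : Literature.NumberTheory.Automorphic.PicardCM.CMAbelianVarietyRealised) :
    Literature.Barriers.HodgeConjecture.Weil1977_exceptionalHodgeClasses := by
  intro n hn
  obtain ⟨k, rfl⟩ : ∃ k, n = k + 2 := ⟨n - 2, by omega⟩
  haveI i9 : IsCyclotomicExtension {9} ℚ (CyclotomicField 9 ℚ) := CyclotomicField.isCyclotomicExtension 9 ℚ
  haveI i3 : IsCyclotomicExtension {3} ℚ (CyclotomicField 3 ℚ) := CyclotomicField.isCyclotomicExtension 3 ℚ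
  haveI := isCMField_nine (CyclotomicField 9 ℚ)
  haveI := isCMField_three (CyclotomicField 3 ℚ)
  obtain ⟨A₉, ι₉, θ₉, h₉⟩ := hreal (CyclotomicField 9 ℚ) (Φ₉ _)
  obtain ⟨A₃, ι₃, θ₃, h₃⟩ := hreal (CyclotomicField 3 ℚ) (Φ₃ _)
  have hdim : (⨁ Afam A₉ A₃ (2 * k + 1)).dim = 2 * (k + 2) := by
    rw [dim_biproduct_Afam h₉ h₃]; ring
  obtain ⟨c, hc⟩ := exists_exceptional_fam h₉ h₃ k
  rw [hdim] at hc
  refine ⟨⨁ Afam A₉ A₃ (2 * k + 1), hdim, ?_, c, hc⟩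
  rw [← hdim]
  exact Motives.AbelianVariety.isSmoothProjective_holds

end WeilTypeWitness

end Literature.AlgebraicGeometry.Pohlmann1968

end
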